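import Literature.Topology.FourManifolds.HandlebodyClassificationProofs
import HarnessLib

/-!
# A smooth embedding onto a regular domain is a diffeomorphism onto it; the sublevel form of a
# handle attachment

Topic `Literature/Topology/FourManifolds` (fact seat
`provefact-Literature.Topology.FourManifolds.IsHandlebody.exists_diffeomorph_isBoundaryGluing_sphere`,
step F2b₁ of the Lickorish–Wallace DAG, which after `LickorishWallaceLeaves.lean` rides on the
single named fact **L1** `Literature.Topology.FourManifolds.oneHandle_nonempty_diffeomorph`
("uniqueness of attaching one `1`-handle", `HandlebodyClassification.lean`; Kosinski,
*Differential Manifolds* (1993), VI (6.6), (11.4)(c), VII (2.2); Milnor, *Lectures on the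
h-cobordism theorem* (1965), Thm. 3.13)).  Everything here is **proved**; no named facts.

L1 is phrased with the Morse-theoretic handle attachments of `Handles.lean`:
`IsHandleAttachment n k W W'` provides a smooth embedding `ι : W → W'` whose range is the
sublevel set `f⁻¹(-∞, a]` of a Morse function `f` adapted to `∂W'`, at a regular level `a < 1`
above which `f` has exactly one critical point, of index `k`.  The handle-extension machinery
of the tree (`HandleConjugation.lean`, `HandleExtensionDiffeo.lean`, `HandleStepAssembly.lean`)
works instead with the *concrete* sublevel sets `↥(f ⁻¹' Iic a)` and their
manifold-with-boundary structure `Literature.Topology.FourManifolds.sublevelAtlas`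
(`RegularSublevelSet.lean`).  This file bridges the two:

* `HalfSliceAtlas.diffeomorphOfIsSmoothEmbedding` — **a smooth embedding of manifolds with
  boundary of the same dimension whose range is a regular domain `S ⊆ M` is a diffeomorphism
  onto `S`** (structure `HalfSliceAtlas.chartedSpace`).  Smoothness into `S` is the tree's
  `HalfSliceAtlas.contMDiff_codRestrict` (Lee 2013, Cor. 5.30); smoothness of the inverse is
  Mathlib's characterisation of smooth maps by composition with an immersion
  (`ContMDiffAt.iff_comp_isImmersionAt`: `ι⁻¹ ∘ incl` is smooth because it is continuous and
  `ι ∘ (ι⁻¹ ∘ incl) = incl` is smooth, `HalfSliceAtlas.contMDiff_subtype_val_of_halfSlice`);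
  Lee (2013), Prop. 5.49 with Thm. 4.14 / Prop. 4.22 (a bijective smooth embedding of
  manifolds with boundary of equal dimension is a diffeomorphism onto a regular domain).
* `IsHandleAttachment.exists_diffeomorph_sublevel` — **the sublevel form of a handle
  attachment**: from `IsHandleAttachment n k W W'` a Morse function `f` adapted to `∂W'`, a
  regular level `a < 1` with the sublevel set in the interior, exactly one critical point above
  `a`, of index `k`, **and a diffeomorphism `W ≅ {f ≤ a}`** onto the sublevel set with its
  structure `sublevelAtlas` (Milnor 1963, Thm. 3.2 / Milnor 1965, Thm. 3.13: "`W' ≅ W ∪ hᵏ`";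
  Kosinski 1993, VII (2.2)).
* `IsHandleAttachment.exists_diffeomorph_sublevel_isConnected` — the same with the transfer of
  the hypothesis of L1 "`∂W` is connected" to **the level `{f = a}` is connected**
  (`Diffeomorph.preimage_boundary`, `isBoundaryPoint_sublevel_iff`), the form in which it feeds
  the two-disc theorem in the level (`TwoDiscsDiffeotopy.lean`).

## References

* J. M. Lee, *Introduction to Smooth Manifolds*, 2nd ed., GTM 218 (2013), Thm. 4.14,
  Prop. 4.22, Prop. 5.49, Cor. 5.30. [LeeSmoothManifolds2013]
* J. Milnor, *Morse theory*, Ann. of Math. Studies 51 (1963), Thms. 3.1–3.2. [Milnor1963]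
* J. Milnor, *Lectures on the h-cobordism theorem* (1965), Lemma 2.9, Thm. 3.13.
  [MilnorHCobordism1965]
* A. A. Kosinski, *Differential Manifolds* (1993), VI (6.6), (11.4)(c), VII (2.2). [Kosinski1993]
-/

open scoped Manifold ContDiff Topology
open Set Function

noncomputable section

namespace Literature.Topology.FourManifolds

universe u v

/-! ### §1 A smooth embedding onto a regular domain is a diffeomorphism onto it -/

namespace HalfSliceAtlas

variable {k : ℕ} {M : Type u} [TopologicalSpace M] [ChartedSpace (EuclideanHalfSpace (k + 1)) M]
  [IsManifold (𝓡∂ (k + 1)) ∞ M] {S : Set M} (Φ : HalfSliceAtlas (𝓡∂ (k + 1)) S)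
  {W : Type v} [TopologicalSpace W] [ChartedSpace (EuclideanHalfSpace (k + 1)) W]

/-- The homeomorphism `W ≃ₜ S` underlying a topological embedding `ι : W → M` with range `S`.
[folklore] -/
def homeomorphOfIsEmbedding {ι : W → M} (hι : Topology.IsEmbedding ι) (hS : range ι = S) : W ≃ₜ S :=
  hι.toHomeomorph.trans (Homeomorph.setCongr hS)

omit [IsManifold (𝓡∂ (k + 1)) ∞ M] [ChartedSpace (EuclideanHalfSpace (k + 1)) W] in
/-- The homeomorphism is `ι` followed by the inclusion. [folklore] -/
@[simp]
theorem coe_homeomorphOfIsEmbedding_apply {ι : W → M} (hι : Topology.IsEmbedding ι) (hS : range ι = S)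
    (w : W) : (homeomorphOfIsEmbedding (S := S) hι hS w : M) = ι w := rfl

omit [IsManifold (𝓡∂ (k + 1)) ∞ M] [ChartedSpace (EuclideanHalfSpace (k + 1)) W] in
/-- `ι` inverts the homeomorphism: `ι (e⁻¹ s) = s`. [folklore] -/
theorem apply_homeomorphOfIsEmbedding_symm {ι : W → M} (hι : Topology.IsEmbedding ι) (hS : range ι = S)
    (s : S) : ι ((homeomorphOfIsEmbedding (S := S) hι hS).symm s) = s := by
  conv_rhs => rw [← (homeomorphOfIsEmbedding (S := S) hι hS).apply_symm_apply s]
  rfl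

/-- **A smooth embedding onto a regular domain is a diffeomorphism onto it.**  Let `S ⊆ M` be a
regular domain of a manifold with boundary `M` (a half-slice atlas `Φ`, structure
`Φ.chartedSpace`) and `ι : W → M` a smooth embedding of a manifold with boundary of the same
dimension with `range ι = S`.  Then `ι` is a diffeomorphism `W ≅ S`: into `S` it is smooth by
`HalfSliceAtlas.contMDiff_codRestrict` (Lee 2013, Cor. 5.30), and its inverse `ι⁻¹ ∘ incl` is
smooth because it is continuous and its composite with the immersion `ι` is the smooth inclusion
`S → M` (`ContMDiffAt.iff_comp_isImmersionAt`,
`HalfSliceAtlas.contMDiff_subtype_val_of_halfSlice`).  Lee (2013), Prop. 5.49 with Prop. 4.22.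
[cite: LeeSmoothManifolds2013, Prop. 5.49 and Cor. 5.30] -/
def diffeomorphOfIsSmoothEmbedding {ι : W → M}
    (hι : Manifold.IsSmoothEmbedding (𝓡∂ (k + 1)) (𝓡∂ (k + 1)) ∞ ι) (hS : range ι = S) :
    letI := Φ.chartedSpace
    W ≃ₘ⟮𝓡∂ (k + 1), 𝓡∂ (k + 1)⟯ S :=
  letI := Φ.chartedSpace
  haveI := Φ.isManifold
  { toEquiv := (homeomorphOfIsEmbedding hι.isEmbedding hS).toEquiv
    contMDiff_toFun := by
      have hmem : ∀ w, ι w ∈ S := fun w => hS ▸ mem_range_self w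
      exact (Φ.contMDiff_codRestrict hmem hι.contMDiff).congr fun w => rfl
    contMDiff_invFun := by
      intro s
      set e := homeomorphOfIsEmbedding (S := S) hι.isEmbedding hS with he
      have himm : Manifold.IsImmersionAt (𝓡∂ (k + 1)) (𝓡∂ (k + 1)) ∞ ι (e.toEquiv.symm s) :=
        hι.isImmersion.isImmersionAt _
      rw [ContMDiffAt.iff_comp_isImmersionAt himm]
      refine ⟨e.symm.continuous.continuousAt, ?_⟩
      have hcomp : ι ∘ (e.toEquiv.symm : S → W) = (Subtype.val : S → M) := by
        funext s'
        exact apply_homeomorphOfIsEmbedding_symm hι.isEmbedding hS s'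
      rw [hcomp]
      exact Φ.contMDiff_subtype_val_of_halfSlice s }

/-- The diffeomorphism is `ι` followed by the inclusion. [folklore] -/
@[simp]
theorem coe_diffeomorphOfIsSmoothEmbedding_apply {ι : W → M}
    (hι : Manifold.IsSmoothEmbedding (𝓡∂ (k + 1)) (𝓡∂ (k + 1)) ∞ ι) (hS : range ι = S) (w : W) :
    letI := Φ.chartedSpace
    ((Φ.diffeomorphOfIsSmoothEmbedding hι hS w : S) : M) = ι w := rfl

/-- `ι` inverts the diffeomorphism. [folklore] -/
theorem apply_diffeomorphOfIsSmoothEmbedding_symm {ι : W → M}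
    (hι : Manifold.IsSmoothEmbedding (𝓡∂ (k + 1)) (𝓡∂ (k + 1)) ∞ ι) (hS : range ι = S) (s : S) :
    letI := Φ.chartedSpace
    ι ((Φ.diffeomorphOfIsSmoothEmbedding hι hS).symm s) = s :=
  apply_homeomorphOfIsEmbedding_symm hι.isEmbedding hS s

end HalfSliceAtlas

/-! ### §2 The sublevel form of a handle attachment -/

section HandleAttachment

/-- Points of a sublevel set `{f ≤ a}`, `a < 1`, of a Morse function adapted to the boundary are
interior points (`f = 1` on the boundary). [cite: MilnorHCobordism1965, Def. 3.1] -/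
theorem IsMorseAdapted.isInteriorPoint_of_apply_le {n : ℕ} {W' : Type u} [TopologicalSpace W']
    [ChartedSpace (EuclideanHalfSpace (n + 1)) W'] {f : W' → ℝ} (hf : IsMorseAdapted (𝓡∂ (n + 1)) f)
    {a : ℝ} (ha : a < 1) (p : W') (hp : f p ≤ a) : (𝓡∂ (n + 1)).IsInteriorPoint p :=
  ((𝓡∂ (n + 1)).isInteriorPoint_or_isBoundaryPoint p).resolve_right fun hb => by
    have h1 : f p = 1 := (hf.2.1 p hb).1
    linarith

variable {n k : ℕ} {W W' : Type u}
  [TopologicalSpace W] [ChartedSpace (EuclideanHalfSpace (n + 1)) W]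
  [TopologicalSpace W'] [ChartedSpace (EuclideanHalfSpace (n + 1)) W'] [IsManifold (𝓡∂ (n + 1)) ∞ W']

/-- **The sublevel form of a handle attachment.**  If `W'` is obtained from `W` by attaching a
`k`-handle (`IsHandleAttachment n k W W'`), then there are a Morse function `f` adapted to `∂W'`
and a level `a < 1` such that: the sublevel set `{f ≤ a}` lies in the interior and `a` is a
regular value (so that `{f ≤ a}` is a compact manifold with boundary `{f = a}` for the structure
`sublevelAtlas`, Milnor 1965, Lemma 2.9), no critical point lies on the level `a`, exactly one
critical point lies above `a` and it has index `k`, and **`W` is diffeomorphic to `{f ≤ a}`**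
(the embedding `ι` of the definition is a diffeomorphism onto its range,
`HalfSliceAtlas.diffeomorphOfIsSmoothEmbedding`).  Milnor, *Morse theory* (1963), Thm. 3.2;
Kosinski (1993), VII (2.2). [cite: Milnor1963, Thm. 3.2] [cite: Kosinski1993, VII (2.2)] -/
theorem IsHandleAttachment.exists_diffeomorph_sublevel (h : IsHandleAttachment n k W W') :
    ∃ (f : W' → ℝ) (a : ℝ) (hf : IsMorseAdapted (𝓡∂ (n + 1)) f)
      (hint : ∀ p, f p ≤ a → (𝓡∂ (n + 1)).IsInteriorPoint p)
      (hreg : ∀ p, f p = a → ¬ IsMCriticalPt (𝓡∂ (n + 1)) f p),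
      a < 1 ∧ (∀ z, IsMCriticalPt (𝓡∂ (n + 1)) f z → f z ≠ a) ∧
      (∃! z, IsMCriticalPt (𝓡∂ (n + 1)) f z ∧ a < f z) ∧
      (∀ z, IsMCriticalPt (𝓡∂ (n + 1)) f z → a < f z → morseIndex (𝓡∂ (n + 1)) f z = k) ∧
      (letI := (sublevelAtlas hf.isMorse.contMDiff a hint hreg).chartedSpace
       Nonempty (W ≃ₘ⟮𝓡∂ (n + 1), 𝓡∂ (n + 1)⟯ ↥(f ⁻¹' Iic a))) := by
  obtain ⟨ι, f, a, hι, hf, ha, hcrit, hrange, hex, hidx⟩ := h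
  have hint : ∀ p, f p ≤ a → (𝓡∂ (n + 1)).IsInteriorPoint p :=
    fun p hp => hf.isInteriorPoint_of_apply_le ha p hp
  have hreg : ∀ p, f p = a → ¬ IsMCriticalPt (𝓡∂ (n + 1)) f p := fun p hp hc => hcrit p hc hp
  exact ⟨f, a, hf, hint, hreg, ha, hcrit, hex, hidx,
    ⟨(sublevelAtlas hf.isMorse.contMDiff a hint hreg).diffeomorphOfIsSmoothEmbedding hι hrange⟩⟩

/-- **The level of a handle attachment with connected `∂W` is connected.**  Under a
diffeomorphism `e : W ≅ {f ≤ a}` onto a regular sublevel set, the boundary `∂W` corresponds to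
the level `{f = a}` (`Diffeomorph.preimage_boundary`; the boundary of `{f ≤ a}` for
`sublevelAtlas` is the level, `isBoundaryPoint_sublevel_iff`, Milnor 1963, Thm. 3.1: "`Mᵃ` is a
smooth manifold with boundary `f⁻¹(a)`"); hence if `∂W` is connected, so is the level set
`f⁻¹(a) ⊆ W'`. [cite: Milnor1963, Thm. 3.1] -/
theorem isConnected_level_of_diffeomorph_sublevel {f : W' → ℝ}
    (hf : ContMDiff (𝓡∂ (n + 1)) 𝓘(ℝ, ℝ) ∞ f) {a : ℝ}
    (hint : ∀ p, f p ≤ a → (𝓡∂ (n + 1)).IsInteriorPoint p)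
    (hreg : ∀ p, f p = a → ¬ IsMCriticalPt (𝓡∂ (n + 1)) f p)
    (e : letI := (sublevelAtlas hf a hint hreg).chartedSpace
      W ≃ₘ⟮𝓡∂ (n + 1), 𝓡∂ (n + 1)⟯ ↥(f ⁻¹' Iic a))
    (hb : IsConnected ((𝓡∂ (n + 1)).boundary W)) : IsConnected (f ⁻¹' {a}) := by
  letI := (sublevelAtlas hf a hint hreg).chartedSpace
  haveI := (sublevelAtlas hf a hint hreg).isManifold
  -- the level is the image of `∂W` under `incl ∘ e`
  have himage : f ⁻¹' {a} = (fun w => ((e w : ↥(f ⁻¹' Iic a)) : W')) '' (𝓡∂ (n + 1)).boundary W := by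
    have hpre : e ⁻¹' (𝓡∂ (n + 1)).boundary ↥(f ⁻¹' Iic a) = (𝓡∂ (n + 1)).boundary W :=
      e.preimage_boundary (by simp)
    ext p
    simp only [mem_preimage, mem_singleton_iff, mem_image]
    constructor
    · intro hp
      refine ⟨e.symm ⟨p, by simp [hp.le]⟩, ?_, by simp⟩
      rw [← hpre, mem_preimage, Diffeomorph.apply_symm_apply]
      exact (isBoundaryPoint_sublevel_iff hf a hint hreg _).2 hp
    · rintro ⟨w, hw, rfl⟩
      rw [← hpre, mem_preimage] at hw
      exact (isBoundaryPoint_sublevel_iff hf a hint hreg _).1 hw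
  rw [himage]
  exact hb.image _ ((continuous_subtype_val.comp e.continuous).continuousOn)

/-- **Sublevel form of a handle attachment with connected level.**  As
`IsHandleAttachment.exists_diffeomorph_sublevel`, for an attachment to a `W` with connected
boundary (the hypothesis of L1 `oneHandle_nonempty_diffeomorph`): in addition the level
`f⁻¹(a)` is connected. [cite: Milnor1963, Thms. 3.1–3.2] [cite: Kosinski1993, VI (11.4)(c)] -/
theorem IsHandleAttachment.exists_diffeomorph_sublevel_isConnected (h : IsHandleAttachment n k W W')
    (hb : IsConnected ((𝓡∂ (n + 1)).boundary W)) :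
    ∃ (f : W' → ℝ) (a : ℝ) (hf : IsMorseAdapted (𝓡∂ (n + 1)) f)
      (hint : ∀ p, f p ≤ a → (𝓡∂ (n + 1)).IsInteriorPoint p)
      (hreg : ∀ p, f p = a → ¬ IsMCriticalPt (𝓡∂ (n + 1)) f p),
      a < 1 ∧ (∀ z, IsMCriticalPt (𝓡∂ (n + 1)) f z → f z ≠ a) ∧
      (∃! z, IsMCriticalPt (𝓡∂ (n + 1)) f z ∧ a < f z) ∧
      (∀ z, IsMCriticalPt (𝓡∂ (n + 1)) f z → a < f z → morseIndex (𝓡∂ (n + 1)) f z = k) ∧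
      IsConnected (f ⁻¹' {a}) ∧
      (letI := (sublevelAtlas hf.isMorse.contMDiff a hint hreg).chartedSpace
       Nonempty (W ≃ₘ⟮𝓡∂ (n + 1), 𝓡∂ (n + 1)⟯ ↥(f ⁻¹' Iic a))) := by
  obtain ⟨f, a, hf, hint, hreg, ha, hcrit, hex, hidx, ⟨e⟩⟩ := h.exists_diffeomorph_sublevel
  exact ⟨f, a, hf, hint, hreg, ha, hcrit, hex, hidx,
    isConnected_level_of_diffeomorph_sublevel hf.isMorse.contMDiff hint hreg e hb, ⟨e⟩⟩

end HandleAttachment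

end Literature.Topology.FourManifolds

end
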